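import Mathlib
import HarnessLib
import Summits.HubbardSuperconductivity.HubbardSuperconductivity.Theorems.KLProgrammeKLRegimeVolumeLimitCouplingExpansion

/-!
# Child 5 `KLRegimeVolumeLimitV7` (stmt-HubbardSuperconductivity-19665) — the ORDER-`U¹` RUNG of the volume-limit carrier, evaluated:
# the frame-dressed Hartree tadpole (seat hubbard-kl-k3c5-p2)

`…VolumeLimitCouplingExpansion` gives `d/dU|₀ Σ̂^K_{L,M}(k,σ;U) = −T(k,σ)/(βL² ĝ_K(k)²)` with the TRUNCATED first-order insertion
`T = ∫dμ_C ψ̂⁺_{kσ}ψ̂⁻_{kσ}W − ⟨ψ̂⁺_{kσ}ψ̂⁻_{kσ}⟩₀ ∫dμ_C W` (`W = V(1)`).  Here `T` is EVALUATED by Wick's rule (integration by parts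
`gaussExpect_gen_mul` against the seedless covariance, which pairs `ψ̂⁺_{qσ}` with `ψ̂⁻_{qσ}` only): of the vertex
`ψ̂⁺_{k₁↑}ψ̂⁻_{k₂↑}ψ̂⁺_{k₃↓}ψ̂⁻_{k₄↓}` only the same-spin pair can join the external legs, the other pair closes into a loop —

  `T(k, σ) = ĝ₀(k)² · Σ_q ĝ₀(q)`,   hence   `d/dU|₀ Σ̂^K(k,σ;U) = −(ĝ₀(k)/ĝ_K(k))² · (βL²)⁻¹ Σ_q ĝ₀(q)`

(`ĝ₀ = 1/(−iω + ξ)` bare, `ĝ_K = 1/(−iω + e_K)` frame; `(ĝ₀/ĝ_K)² = ((−iω + e_K)/(−iω + ξ))²` is the square of the zero-coupling dressing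
of `…VolumeLimitZeroCoupling`; `(βL²)⁻¹Σ_q ĝ₀(q)` is the symmetrically truncated Hartree tadpole of `HubbardTruncatedHartree`, real and
bounded by `½` uniformly in the volume).  Everything is proved; no definition.
-/

noncomputable section

namespace Summit.HubbardSuperconductivity.HubbardSuperconductivity.Theorems.TwoPointAssembly

set_option linter.dupNamespace false -- summit = problem name (single-conjunct summit), D-0017

open Finset Filter Topology Literature.MathematicalPhysics.QuantumLattice Literature.Probability.LatticeModels GrassmannAlgebra
open Summit.HubbardSuperconductivity.HubbardSuperconductivity.Theorems.KLRegimeSplit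
open Summit.HubbardSuperconductivity.HubbardSuperconductivity.Theorems.KLProgrammeLegKernels

variable {L M : ℕ} [NeZero L]

/-! ## §1 Integration by parts against the seedless frame covariance -/

/-- Integration by parts with the pair function: `∫dμ_C ψ(X) a = Σ_Y A(X,Y) ∫dμ_C ∂_Y a`. -/
theorem gaussExpect_gen_mul_eq_sum_contr (C : Matrix (HubbardFieldIdx L M) (HubbardFieldIdx L M) ℂ) (X : HubbardFieldIdx L M)
    (a : HubbardGrassmann L M) :
    gaussExpect ℂ C (gen ℂ X * a) = ∑ Y, contr ℂ C X Y * gaussExpect ℂ C (grassmannDeriv ℂ Y a) := by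
  rw [gaussExpect_gen_mul]
  simp only [← contr_apply]

/-- `∫dμ_{C^K} ψ̂⁺_{qσ} a = −βL² ĝ_K(q) · ∫dμ_{C^K} ∂_{ψ̂⁻_{qσ}} a` (seed `0`, `β ≠ 0`). -/
theorem gaussExpect_psiPlus_mul {β : ℝ} (hβ : β ≠ 0) (μ : ℝ) (K : TrigPolyC4v) (q : FreqMomentum L M) (σ : Fin 2)
    (a : HubbardGrassmann L M) :
    gaussExpect ℂ (hubbardCovarianceCT L M β μ 0 K) (gen ℂ (((q, σ), 0) : HubbardFieldIdx L M) * a) =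
      -(((β * (L : ℝ) ^ 2 : ℝ) : ℂ) * propCT L M β μ K q) *
        gaussExpect ℂ (hubbardCovarianceCT L M β μ 0 K) (grassmannDeriv ℂ (((q, σ), 1) : HubbardFieldIdx L M) a) := by
  rw [gaussExpect_gen_mul_eq_sum_contr, Finset.sum_eq_single (((q, σ), 1) : HubbardFieldIdx L M), contr_plus_minus hβ]
  · intro Y _ hY; rw [contr_plus_eq_zero β μ K q σ hY, zero_mul]
  · intro h; exact absurd (Finset.mem_univ _) h

/-- `∫dμ_{C^K} ψ̂⁻_{qσ} a = +βL² ĝ_K(q) · ∫dμ_{C^K} ∂_{ψ̂⁺_{qσ}} a` (seed `0`, `β ≠ 0`). -/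
theorem gaussExpect_psiMinus_mul {β : ℝ} (hβ : β ≠ 0) (μ : ℝ) (K : TrigPolyC4v) (q : FreqMomentum L M) (σ : Fin 2)
    (a : HubbardGrassmann L M) :
    gaussExpect ℂ (hubbardCovarianceCT L M β μ 0 K) (gen ℂ (((q, σ), 1) : HubbardFieldIdx L M) * a) =
      (((β * (L : ℝ) ^ 2 : ℝ) : ℂ) * propCT L M β μ K q) *
        gaussExpect ℂ (hubbardCovarianceCT L M β μ 0 K) (grassmannDeriv ℂ (((q, σ), 0) : HubbardFieldIdx L M) a) := by
  rw [gaussExpect_gen_mul_eq_sum_contr, Finset.sum_eq_single (((q, σ), 0) : HubbardFieldIdx L M), contr_minus_plus hβ]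
  · intro Y _ hY; rw [contr_minus_eq_zero β μ K q σ hY, zero_mul]
  · intro h; exact absurd (Finset.mem_univ _) h

/-- `∫dμ_{C^K} ψ̂⁺_{qσ} ψ̂⁻_{q'σ'} = [q' = q ∧ σ' = σ]·(−βL² ĝ_K(q))`. -/
theorem gaussExpect_psiPlus_psiMinus {β : ℝ} (hβ : β ≠ 0) (μ : ℝ) (K : TrigPolyC4v) (q q' : FreqMomentum L M) (σ σ' : Fin 2) :
    gaussExpect ℂ (hubbardCovarianceCT L M β μ 0 K)
        (gen ℂ (((q, σ), 0) : HubbardFieldIdx L M) * gen ℂ (((q', σ'), 1) : HubbardFieldIdx L M)) =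
      if q' = q ∧ σ' = σ then -(((β * (L : ℝ) ^ 2 : ℝ) : ℂ) * propCT L M β μ K q) else 0 := by
  rw [gaussExpect_psiPlus_mul hβ, grassmannDeriv_gen, apply_ite (gaussExpect ℂ (hubbardCovarianceCT L M β μ 0 K)), gaussExpect_one,
    map_zero]
  by_cases h : q' = q ∧ σ' = σ
  · rw [if_pos h, if_pos (by rw [h.1, h.2]), mul_one]
  · rw [if_neg h, if_neg (fun h' => h ?_), mul_zero]
    simp only [Prod.mk.injEq] at h'
    exact ⟨h'.1.1.symm, h'.1.2.symm⟩

/-- The same for the named generators `psiPlus`/`psiMinus`. -/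
theorem gaussExpect_psiPlus_mul_psiMinus {β : ℝ} (hβ : β ≠ 0) (μ : ℝ) (K : TrigPolyC4v) (q q' : FreqMomentum L M)
    (σ σ' : Fin 2) :
    gaussExpect ℂ (hubbardCovarianceCT L M β μ 0 K) (psiPlus q σ * psiMinus q' σ') =
      if q' = q ∧ σ' = σ then -(((β * (L : ℝ) ^ 2 : ℝ) : ℂ) * propCT L M β μ K q) else 0 :=
  gaussExpect_psiPlus_psiMinus hβ μ K q q' σ σ'

/-! ## §2 Derivatives of the vertex monomial `ψ̂⁺_{k₁↑}ψ̂⁻_{k₂↑}ψ̂⁺_{k₃↓}ψ̂⁻_{k₄↓}` -/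

omit [NeZero L] in
/-- `∂_{ψ̂⁻_{k↑}} (ψ̂⁺_{k₁↑}ψ̂⁻_{k₂↑}ψ̂⁺_{k₃↓}ψ̂⁻_{k₄↓}) = −[k₂ = k] ψ̂⁺_{k₁↑}ψ̂⁺_{k₃↓}ψ̂⁻_{k₄↓}`. -/
theorem grassmannDeriv_psiMinus_up_vertexMonomial (k k₁ k₂ k₃ k₄ : FreqMomentum L M) :
    grassmannDeriv ℂ (((k, 0), 1) : HubbardFieldIdx L M) (psiPlus k₁ 0 * psiMinus k₂ 0 * psiPlus k₃ 1 * psiMinus k₄ 1) =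
      -(if k₂ = k then psiPlus k₁ 0 * (psiPlus k₃ 1 * psiMinus k₄ 1) else 0) := by
  simp only [psiPlus, psiMinus, mul_assoc, grassmannDeriv_gen_mul, grassmannDeriv_gen]
  by_cases h : k₂ = k
  · subst h; simp
  · simp [h, Ne.symm h]

omit [NeZero L] in
/-- `∂_{ψ̂⁻_{k↓}} (ψ̂⁺_{k₁↑}ψ̂⁻_{k₂↑}ψ̂⁺_{k₃↓}ψ̂⁻_{k₄↓}) = −[k₄ = k] ψ̂⁺_{k₁↑}ψ̂⁻_{k₂↑}ψ̂⁺_{k₃↓}`. -/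
theorem grassmannDeriv_psiMinus_down_vertexMonomial (k k₁ k₂ k₃ k₄ : FreqMomentum L M) :
    grassmannDeriv ℂ (((k, 1), 1) : HubbardFieldIdx L M) (psiPlus k₁ 0 * psiMinus k₂ 0 * psiPlus k₃ 1 * psiMinus k₄ 1) =
      -(if k₄ = k then psiPlus k₁ 0 * (psiMinus k₂ 0 * psiPlus k₃ 1) else 0) := by
  simp only [psiPlus, psiMinus, mul_assoc, grassmannDeriv_gen_mul, grassmannDeriv_gen]
  by_cases h : k₄ = k
  · subst h; simp
  · simp [h, Ne.symm h]

omit [NeZero L] in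
/-- `∂_{ψ̂⁺_{k↑}} (ψ̂⁺_{k₁↑}ψ̂⁺_{k₃↓}ψ̂⁻_{k₄↓}) = [k₁ = k] ψ̂⁺_{k₃↓}ψ̂⁻_{k₄↓}`. -/
theorem grassmannDeriv_psiPlus_up_three (k k₁ k₃ k₄ : FreqMomentum L M) :
    grassmannDeriv ℂ (((k, 0), 0) : HubbardFieldIdx L M) (psiPlus k₁ 0 * (psiPlus k₃ 1 * psiMinus k₄ 1)) =
      if k₁ = k then psiPlus k₃ 1 * psiMinus k₄ 1 else 0 := by
  simp only [psiPlus, psiMinus, grassmannDeriv_gen_mul, grassmannDeriv_gen]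
  by_cases h : k₁ = k
  · subst h; simp
  · simp [h, Ne.symm h]

omit [NeZero L] in
/-- `∂_{ψ̂⁺_{k↓}} (ψ̂⁺_{k₁↑}ψ̂⁻_{k₂↑}ψ̂⁺_{k₃↓}) = [k₃ = k] ψ̂⁺_{k₁↑}ψ̂⁻_{k₂↑}`. -/
theorem grassmannDeriv_psiPlus_down_three (k k₁ k₂ k₃ : FreqMomentum L M) :
    grassmannDeriv ℂ (((k, 1), 0) : HubbardFieldIdx L M) (psiPlus k₁ 0 * (psiMinus k₂ 0 * psiPlus k₃ 1)) =
      if k₃ = k then psiPlus k₁ 0 * psiMinus k₂ 0 else 0 := by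
  simp only [psiPlus, psiMinus, grassmannDeriv_gen_mul, grassmannDeriv_gen]
  by_cases h : k₃ = k
  · subst h; simp
  · simp [h, Ne.symm h]

/-! ## §3 The six-point function: external pair times one vertex monomial -/

/-- **Spin `↑` external pair against the vertex monomial** (bare seedless covariance, frame `0`):
`∫ ψ̂⁺_{k↑}ψ̂⁻_{k↑} m = ⟨ψ̂⁺_{k↑}ψ̂⁻_{k↑}⟩₀ ∫ m + [k₁ = k₂ = k, k₃ = k₄] (βL²)³ ĝ₀(k)² ĝ₀(k₃)` — disconnected part plus the tadpole. -/
theorem gaussExpect_pairUp_mul_vertexMonomial {β : ℝ} (hβ : β ≠ 0) (μ : ℝ) (k k₁ k₂ k₃ k₄ : FreqMomentum L M) :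
    gaussExpect ℂ (hubbardCovarianceCT L M β μ 0 0)
        (gen ℂ (((k, 0), 0) : HubbardFieldIdx L M) * (gen ℂ (((k, 0), 1) : HubbardFieldIdx L M) *
          (psiPlus k₁ 0 * psiMinus k₂ 0 * psiPlus k₃ 1 * psiMinus k₄ 1))) =
      -(((β * (L : ℝ) ^ 2 : ℝ) : ℂ) * propCT L M β μ 0 k) *
          gaussExpect ℂ (hubbardCovarianceCT L M β μ 0 0) (psiPlus k₁ 0 * psiMinus k₂ 0 * psiPlus k₃ 1 * psiMinus k₄ 1) +
        (if k₁ = k ∧ k₂ = k ∧ k₄ = k₃ then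
          ((β * (L : ℝ) ^ 2 : ℝ) : ℂ) ^ 3 * propCT L M β μ 0 k ^ 2 * propCT L M β μ 0 k₃ else 0) := by
  rw [gaussExpect_psiPlus_mul hβ, grassmannDeriv_gen_mul, if_pos rfl, map_sub, grassmannDeriv_psiMinus_up_vertexMonomial,
    mul_neg, map_neg, sub_neg_eq_add]
  by_cases h2 : k₂ = k
  · rw [if_pos h2, gaussExpect_psiMinus_mul hβ, grassmannDeriv_psiPlus_up_three]
    by_cases h1 : k₁ = k
    · rw [if_pos h1, gaussExpect_psiPlus_mul_psiMinus hβ]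
      by_cases h3 : k₄ = k₃
      · rw [if_pos ⟨h3, rfl⟩, if_pos ⟨h1, h2, h3⟩]; ring
      · rw [if_neg (fun h => h3 h.1), if_neg (fun h => h3 h.2.2)]; ring
    · rw [if_neg h1, map_zero, mul_zero, if_neg (fun h => h1 h.1)]; ring
  · rw [if_neg h2, mul_zero, map_zero, add_zero, if_neg (fun h => h2 h.2.1), add_zero]

/-- **Spin `↓` external pair against the vertex monomial**:
`∫ ψ̂⁺_{k↓}ψ̂⁻_{k↓} m = ⟨ψ̂⁺_{k↓}ψ̂⁻_{k↓}⟩₀ ∫ m + [k₃ = k₄ = k, k₁ = k₂] (βL²)³ ĝ₀(k)² ĝ₀(k₁)`. -/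
theorem gaussExpect_pairDown_mul_vertexMonomial {β : ℝ} (hβ : β ≠ 0) (μ : ℝ) (k k₁ k₂ k₃ k₄ : FreqMomentum L M) :
    gaussExpect ℂ (hubbardCovarianceCT L M β μ 0 0)
        (gen ℂ (((k, 1), 0) : HubbardFieldIdx L M) * (gen ℂ (((k, 1), 1) : HubbardFieldIdx L M) *
          (psiPlus k₁ 0 * psiMinus k₂ 0 * psiPlus k₃ 1 * psiMinus k₄ 1))) =
      -(((β * (L : ℝ) ^ 2 : ℝ) : ℂ) * propCT L M β μ 0 k) *
          gaussExpect ℂ (hubbardCovarianceCT L M β μ 0 0) (psiPlus k₁ 0 * psiMinus k₂ 0 * psiPlus k₃ 1 * psiMinus k₄ 1) +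
        (if k₃ = k ∧ k₄ = k ∧ k₂ = k₁ then
          ((β * (L : ℝ) ^ 2 : ℝ) : ℂ) ^ 3 * propCT L M β μ 0 k ^ 2 * propCT L M β μ 0 k₁ else 0) := by
  rw [gaussExpect_psiPlus_mul hβ, grassmannDeriv_gen_mul, if_pos rfl, map_sub, grassmannDeriv_psiMinus_down_vertexMonomial,
    mul_neg, map_neg, sub_neg_eq_add]
  by_cases h4 : k₄ = k
  · rw [if_pos h4, gaussExpect_psiMinus_mul hβ, grassmannDeriv_psiPlus_down_three]
    by_cases h3 : k₃ = k
    · rw [if_pos h3, gaussExpect_psiPlus_mul_psiMinus hβ]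
      by_cases h21 : k₂ = k₁
      · rw [if_pos ⟨h21, rfl⟩, if_pos ⟨h3, h4, h21⟩]; ring
      · rw [if_neg (fun h => h21 h.1), if_neg (fun h => h21 h.2.2)]; ring
    · rw [if_neg h3, map_zero, mul_zero, if_neg (fun h => h3 h.1)]; ring
  · rw [if_neg h4, mul_zero, map_zero, add_zero, if_neg (fun h => h4 h.2.1), add_zero]

/-! ## §4 The truncated first-order insertion: the vertex sum -/

/-- Gaussian expectation of a guarded element. -/
theorem gaussExpect_ite (C : Matrix (HubbardFieldIdx L M) (HubbardFieldIdx L M) ℂ) (p : Prop) [Decidable p]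
    (x : HubbardGrassmann L M) : gaussExpect ℂ C (if p then x else 0) = if p then gaussExpect ℂ C x else 0 := by
  split_ifs <;> simp

/-- The tadpole sum, spin `↑` kinematics: `Σ_{k₁k₂k₃k₄} [k₁ = k₂ = k, k₄ = k₃] X(k₃) = Σ_q X(q)`. -/
theorem sum_four_tadpole_up (X : FreqMomentum L M → ℂ) (k : FreqMomentum L M) :
    ∑ k₁ : FreqMomentum L M, ∑ k₂ : FreqMomentum L M, ∑ k₃ : FreqMomentum L M, ∑ k₄ : FreqMomentum L M,
        (if k₁ = k ∧ k₂ = k ∧ k₄ = k₃ then X k₃ else 0) = ∑ q : FreqMomentum L M, X q := by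
  rw [Finset.sum_eq_single k]
  · rw [Finset.sum_eq_single k]
    · refine Finset.sum_congr rfl fun k₃ _ => ?_
      simp
    · intro k₂ _ h; simp [h]
    · intro h; exact absurd (Finset.mem_univ _) h
  · intro k₁ _ h; simp [h]
  · intro h; exact absurd (Finset.mem_univ _) h

/-- The tadpole sum, spin `↓` kinematics: `Σ_{k₁k₂k₃k₄} [k₃ = k₄ = k, k₂ = k₁] X(k₁) = Σ_q X(q)`. -/
theorem sum_four_tadpole_down (X : FreqMomentum L M → ℂ) (k : FreqMomentum L M) :
    ∑ k₁ : FreqMomentum L M, ∑ k₂ : FreqMomentum L M, ∑ k₃ : FreqMomentum L M, ∑ k₄ : FreqMomentum L M,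
        (if k₃ = k ∧ k₄ = k ∧ k₂ = k₁ then X k₁ else 0) = ∑ q : FreqMomentum L M, X q := by
  refine Finset.sum_congr rfl fun k₁ _ => ?_
  rw [Finset.sum_eq_single k₁]
  · rw [Finset.sum_eq_single k]
    · rw [Finset.sum_eq_single k]
      · simp
      · intro k₄ _ h; simp [h]
      · intro h; exact absurd (Finset.mem_univ _) h
    · intro k₃ _ h; simp [h]
    · intro h; exact absurd (Finset.mem_univ _) h
  · intro k₂ _ h; simp [h]
  · intro h; exact absurd (Finset.mem_univ _) h

/-- **The truncated first-order insertion is the Hartree tadpole**: for the bare seedless covariance `C` and `W = V(1)`,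
`∫dμ_C ψ̂⁺_{kσ}ψ̂⁻_{kσ} W − ⟨ψ̂⁺_{kσ}ψ̂⁻_{kσ}⟩₀ ∫dμ_C W = ĝ₀(k)² · Σ_q ĝ₀(q)` (`β ≠ 0`). -/
theorem truncated_firstOrder_insertion_eq {β : ℝ} (hβ : β ≠ 0) (μ : ℝ) (k : FreqMomentum L M) (σ : Fin 2) :
    gaussExpect ℂ (hubbardCovariance L M β μ 0)
          (gen ℂ (((k, σ), 0) : HubbardFieldIdx L M) * gen ℂ (((k, σ), 1) : HubbardFieldIdx L M) * hubbardInteraction L M β 1) -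
        gaussExpect ℂ (hubbardCovariance L M β μ 0)
            (gen ℂ (((k, σ), 0) : HubbardFieldIdx L M) * gen ℂ (((k, σ), 1) : HubbardFieldIdx L M)) *
          gaussExpect ℂ (hubbardCovariance L M β μ 0) (hubbardInteraction L M β 1) =
      propCT L M β μ 0 k ^ 2 * ∑ q : FreqMomentum L M, propCT L M β μ 0 q := by
  have hβL : ((β * (L : ℝ) ^ 2 : ℝ) : ℂ) ≠ 0 := by
    have hL : (L : ℝ) ≠ 0 := by exact_mod_cast NeZero.ne L
    exact_mod_cast mul_ne_zero hβ (pow_ne_zero 2 hL)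
  rw [← hubbardCovarianceCT_zero_frame]
  set C := hubbardCovarianceCT L M β μ 0 0 with hC
  set c : ℂ := ((β * (L : ℝ) ^ 2 : ℝ) : ℂ) with hc
  -- the vertex as `r • S`
  set S : HubbardGrassmann L M := ∑ k₁ : FreqMomentum L M, ∑ k₂ : FreqMomentum L M, ∑ k₃ : FreqMomentum L M,
      ∑ k₄ : FreqMomentum L M,
        (if matsubaraInt M k₁.1 + matsubaraInt M k₃.1 = matsubaraInt M k₂.1 + matsubaraInt M k₄.1 ∧ k₁.2 + k₃.2 = k₂.2 + k₄.2 then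
          psiPlus k₁ 0 * psiMinus k₂ 0 * psiPlus k₃ 1 * psiMinus k₄ 1 else 0) with hS
  have hW : hubbardInteraction L M β 1 = (((1 / (β * (L : ℝ) ^ 2) ^ 3 : ℝ) : ℂ)) • S := by rw [hubbardInteraction]
  have hr : (((1 / (β * (L : ℝ) ^ 2) ^ 3 : ℝ) : ℂ)) = (c ^ 3)⁻¹ := by rw [hc]; push_cast; ring
  -- the disconnected sum
  set ES : ℂ := ∑ k₁ : FreqMomentum L M, ∑ k₂ : FreqMomentum L M, ∑ k₃ : FreqMomentum L M, ∑ k₄ : FreqMomentum L M,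
      (if matsubaraInt M k₁.1 + matsubaraInt M k₃.1 = matsubaraInt M k₂.1 + matsubaraInt M k₄.1 ∧ k₁.2 + k₃.2 = k₂.2 + k₄.2 then
        gaussExpect ℂ C (psiPlus k₁ 0 * psiMinus k₂ 0 * psiPlus k₃ 1 * psiMinus k₄ 1) else 0) with hES
  have hE_S : gaussExpect ℂ C S = ES := by
    simp only [hS, hES, map_sum, gaussExpect_ite]
  -- the six-point sum
  have hpair : gaussExpect ℂ C (gen ℂ (((k, σ), 0) : HubbardFieldIdx L M) * gen ℂ (((k, σ), 1) : HubbardFieldIdx L M)) =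
      -(c * propCT L M β μ 0 k) := by
    rw [hC, gaussExpect_psiPlus_psiMinus hβ, if_pos ⟨rfl, rfl⟩]
  have hE_abS : gaussExpect ℂ C (gen ℂ (((k, σ), 0) : HubbardFieldIdx L M) * (gen ℂ (((k, σ), 1) : HubbardFieldIdx L M) * S)) =
      -(c * propCT L M β μ 0 k) * ES + c ^ 3 * propCT L M β μ 0 k ^ 2 * ∑ q : FreqMomentum L M, propCT L M β μ 0 q := by
    simp only [hS, Finset.mul_sum, mul_ite, mul_zero, map_sum, gaussExpect_ite]
    fin_cases σ
    · simp only [Fin.zero_eta, Fin.isValue, hC, gaussExpect_pairUp_mul_vertexMonomial hβ]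
      have hsplit : ∀ (k₁ k₂ k₃ k₄ : FreqMomentum L M),
          (if matsubaraInt M k₁.1 + matsubaraInt M k₃.1 = matsubaraInt M k₂.1 + matsubaraInt M k₄.1 ∧ k₁.2 + k₃.2 = k₂.2 + k₄.2 then
            -(((β * (L : ℝ) ^ 2 : ℝ) : ℂ) * propCT L M β μ 0 k) *
                gaussExpect ℂ (hubbardCovarianceCT L M β μ 0 0) (psiPlus k₁ 0 * psiMinus k₂ 0 * psiPlus k₃ 1 * psiMinus k₄ 1) +
              (if k₁ = k ∧ k₂ = k ∧ k₄ = k₃ then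
                ((β * (L : ℝ) ^ 2 : ℝ) : ℂ) ^ 3 * propCT L M β μ 0 k ^ 2 * propCT L M β μ 0 k₃ else 0)
           else 0) =
          -(c * propCT L M β μ 0 k) *
              (if matsubaraInt M k₁.1 + matsubaraInt M k₃.1 = matsubaraInt M k₂.1 + matsubaraInt M k₄.1 ∧ k₁.2 + k₃.2 = k₂.2 + k₄.2
                then gaussExpect ℂ (hubbardCovarianceCT L M β μ 0 0) (psiPlus k₁ 0 * psiMinus k₂ 0 * psiPlus k₃ 1 * psiMinus k₄ 1)
                else 0) +
            (if k₁ = k ∧ k₂ = k ∧ k₄ = k₃ then c ^ 3 * propCT L M β μ 0 k ^ 2 * propCT L M β μ 0 k₃ else 0) := by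
        intro k₁ k₂ k₃ k₄
        by_cases hA : k₁ = k ∧ k₂ = k ∧ k₄ = k₃
        · obtain ⟨h1, h2, h3⟩ := hA
          subst h1; subst h2; subst h3
          simp [hc]
        · rw [if_neg hA]
          split_ifs <;> simp [hc]
      simp only [hsplit, Finset.sum_add_distrib, ← Finset.mul_sum, sum_four_tadpole_up, hES, hC]
    · simp only [Fin.mk_one, Fin.isValue, hC, gaussExpect_pairDown_mul_vertexMonomial hβ]
      have hsplit : ∀ (k₁ k₂ k₃ k₄ : FreqMomentum L M),
          (if matsubaraInt M k₁.1 + matsubaraInt M k₃.1 = matsubaraInt M k₂.1 + matsubaraInt M k₄.1 ∧ k₁.2 + k₃.2 = k₂.2 + k₄.2 then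
            -(((β * (L : ℝ) ^ 2 : ℝ) : ℂ) * propCT L M β μ 0 k) *
                gaussExpect ℂ (hubbardCovarianceCT L M β μ 0 0) (psiPlus k₁ 0 * psiMinus k₂ 0 * psiPlus k₃ 1 * psiMinus k₄ 1) +
              (if k₃ = k ∧ k₄ = k ∧ k₂ = k₁ then
                ((β * (L : ℝ) ^ 2 : ℝ) : ℂ) ^ 3 * propCT L M β μ 0 k ^ 2 * propCT L M β μ 0 k₁ else 0)
           else 0) =
          -(c * propCT L M β μ 0 k) *
              (if matsubaraInt M k₁.1 + matsubaraInt M k₃.1 = matsubaraInt M k₂.1 + matsubaraInt M k₄.1 ∧ k₁.2 + k₃.2 = k₂.2 + k₄.2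
                then gaussExpect ℂ (hubbardCovarianceCT L M β μ 0 0) (psiPlus k₁ 0 * psiMinus k₂ 0 * psiPlus k₃ 1 * psiMinus k₄ 1)
                else 0) +
            (if k₃ = k ∧ k₄ = k ∧ k₂ = k₁ then c ^ 3 * propCT L M β μ 0 k ^ 2 * propCT L M β μ 0 k₁ else 0) := by
        intro k₁ k₂ k₃ k₄
        by_cases hA : k₃ = k ∧ k₄ = k ∧ k₂ = k₁
        · obtain ⟨h1, h2, h3⟩ := hA
          subst h1; subst h2; subst h3
          simp [hc]
        · rw [if_neg hA]
          split_ifs <;> simp [hc]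
      simp only [hsplit, Finset.sum_add_distrib, ← Finset.mul_sum, sum_four_tadpole_down, hES, hC]
  -- assemble
  rw [mul_assoc, hW, mul_smul_comm, mul_smul_comm, map_smul, map_smul, hE_abS, hE_S, hpair, smul_eq_mul, smul_eq_mul, hr]
  have hc3 : c ^ 3 ≠ 0 := pow_ne_zero 3 hβL
  field_simp
  ring

/-! ## §5 The order-`U¹` rung, evaluated -/

/-- **`d/dU|₀ Σ̂^K_{L,M}(k,σ;U) = −(ĝ₀(k)/ĝ_K(k))² · (βL²)⁻¹ Σ_q ĝ₀(q)`** — the Hartree tadpole of the opposite spin, dressed by the square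
of the zero-coupling frame factor (`β ≠ 0`). -/
theorem hasDerivAt_selfEnergy_fullActionCT_zero_hartree {β : ℝ} (hβ : β ≠ 0) (μ : ℝ) (K : TrigPolyC4v) (k : FreqMomentum L M)
    (σ : Fin 2) :
    HasDerivAt (fun U : ℝ => selfEnergy L M β (fullActionCT L M β U μ K) k σ)
      (-(propCT L M β μ 0 k / propCT L M β μ K k) ^ 2 *
        ((∑ q : FreqMomentum L M, propCT L M β μ 0 q) / ((β * (L : ℝ) ^ 2 : ℝ) : ℂ))) 0 := by
  have hβL : ((β * (L : ℝ) ^ 2 : ℝ) : ℂ) ≠ 0 := by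
    have hL : (L : ℝ) ≠ 0 := by exact_mod_cast NeZero.ne L
    exact_mod_cast mul_ne_zero hβ (pow_ne_zero 2 hL)
  have hg := propCT_ne_zero (L := L) hβ μ K k
  refine (hasDerivAt_selfEnergy_fullActionCT_zero hβ μ K k σ).congr_deriv ?_
  have hT := truncated_firstOrder_insertion_eq hβ μ k σ
  rw [show ∀ a b d : ℂ, (-a + b) / d = -(a - b) / d from fun a b d => by ring, hT]
  field_simp

/-- **The ORDER-`U¹` RUNG of the VL carrier, evaluated**: for `β > 0`,
`d/dU|₀ klSelfEnergy L M β U μ K klE0 (nScales β + 1) k σ = −(ĝ₀(k)/ĝ_K(k))² · (βL²)⁻¹ Σ_q ĝ₀(q)`. -/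
theorem hasDerivAt_klSelfEnergy_nScales_succ_zero_hartree {β : ℝ} (hβ : 0 < β) (μ : ℝ) (K : TrigPolyC4v)
    (k : FreqMomentum L M) (σ : Fin 2) :
    HasDerivAt (fun U : ℝ => klSelfEnergy L M β U μ K klE0 (nScales β + 1) k σ)
      (-(propCT L M β μ 0 k / propCT L M β μ K k) ^ 2 *
        ((∑ q : FreqMomentum L M, propCT L M β μ 0 q) / ((β * (L : ℝ) ^ 2 : ℝ) : ℂ))) 0 := by
  have hfun : (fun U : ℝ => klSelfEnergy L M β U μ K klE0 (nScales β + 1) k σ) =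
      fun U : ℝ => selfEnergy L M β (fullActionCT L M β U μ K) k σ := by
    funext U
    rw [klSelfEnergy, klEffectiveAction_nScales_succ L M hβ, ← fullActionCT]
  rw [hfun]
  exact hasDerivAt_selfEnergy_fullActionCT_zero_hartree hβ.ne' μ K k σ

omit [NeZero L] in
/-- The frame dressing at zero coupling is `ĝ₀/ĝ_K = (−iω + e_K)/(−iω + ξ) = 1 − K(p)·ĝ₀` (closed form, `β ≠ 0`). -/
theorem propCT_zero_div_propCT {β : ℝ} (hβ : β ≠ 0) (μ : ℝ) (K : TrigPolyC4v) (k : FreqMomentum L M) :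
    propCT L M β μ 0 k / propCT L M β μ K k =
      (-Complex.I * (matsubaraFreq β M k.1 : ℂ) + (nambuXiCT L μ K k.2 : ℂ)) /
        (-Complex.I * (matsubaraFreq β M k.1 : ℂ) + (nambuXiCT L μ 0 k.2 : ℂ)) := by
  have hDK := neg_I_mul_matsubaraFreq_add_ne_zero (M := M) hβ k.1 (nambuXiCT L μ K k.2)
  have hD0 := neg_I_mul_matsubaraFreq_add_ne_zero (M := M) hβ k.1 (nambuXiCT L μ 0 k.2)
  rw [propCT, propCT]
  field_simp

end Summit.HubbardSuperconductivity.HubbardSuperconductivity.Theorems.TwoPointAssembly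

end
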